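import Summits.CriticalPhenomena.SAWScalingLimit.Theses.SAWParafermion
import Summits.CriticalPhenomena.SAWScalingLimit.Theses.SAWRenewalTightness
import Summits.CriticalPhenomena.SAWScalingLimit.Theorems.SubseqIdentification.Negative.EndpointLoadBearing
import Summits.CriticalPhenomena.SAWScalingLimit.Theorems.SubseqIdentification.Negative.Necessity
import Summits.CriticalPhenomena.SAWScalingLimit.Theorems.SubseqIdentification.Negative.ProbabilityRedundant

/-!
# Line `boundary-area-law` for crux `SubseqIdentification` (stmt-CriticalPhenomena-0783; primary decl
# `SAWParafermion.SubseqIdentification`, identical shared decl `SAWRenewalTightness.SubseqIdentification`)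

Planner skeleton — crux-plan GENERATION 2 (round 1; idea `Ideas/boundary-area-law.md`, ideator 2; triage
r1-1 fail "κ-pin idle where it docks", r1-2 pass with four sharpenings, r1-3 fail "partial transfer /
standalone"; generation-1 skeleton `sha 268a003d` by planner-cruxplan-…-boundary-area-law-0, re-audited and
RESHAPED here against the disprover's CYCLE-2 `Disproof.lean` (landed 2026-08-16T02:27:54Z, which
generation 1 had not read). Namespace `…Cruxes.SubseqIdentification.BoundaryAreaLaw`; every stub is stated
over TREE VOCABULARY ONLY (`SAW.law`, `SAW.IsEndpointApprox`, `SAW.DomainSAW.curve`, `CurveClass.range`,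
`IsSLELaw`, `DobrushinDomain`, `Metric.infDist`), so each lands verbatim as a `Theorems/…` file
(`--supports stmt-CriticalPhenomena-0783`) without importing this workfile.

THE CRUX (fixed, the route's decl): every subsequential weak limit `μ` (along `s → 0⁺`) of the critical
`δℤ²` SAW laws of a Dobrushin domain `(D; a, b)` with endpoint approximation `(a_δ, b_δ)` is the chordal
SLE_{8/3} law of `(D; a, b)`.

THE LINE. The idea's lever is an AREA LAW for boundary touches: at a flat lattice wall the critical SAW
comes within `r` of a wall point `x₀ ∉ {a, b}` with probability `≍ r²`, two-sidedly, with ONE pair of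
constants for all `0 < r ≤ ε₀` as `δ → 0⁺` (mechanism: exact peeling/restriction identity of `SAW.law`
+ layer-summed bump comparability + boundary rarity, which in fact gives the law at FIXED mesh for all
mesoscopic `2δ ≤ r ≤ ε₀`, see `latticeAreaLaw_of_fixedMesh`); among chordal SLE_κ laws the
boundary-approach exponent is `8/κ − 1` (Alberts–Kozdron), `= 2` iff `κ = 8/3`. As all three triagers
note, an exponent pins `κ` only AFTER something has put the limit inside the SLE_κ family: that input is
the DOCK (S1, "identification up to κ, one κ per mesh sequence" — the Schramm-principle output of any
conformal-covariance-first line; it is the crux-hard CONFORMAL half and is IMPORTED, exactly as the idea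
card's `Transfer:` says). The skeleton is arranged so that (i) the dock is ONE named stub in the weakest
form that ties `κ` across domains, (ii) the area law is needed in ONE REFERENCE DOMAIN ONLY — a lattice
square, where "flat wall" is literal and axis-parallel (a general Jordan `D` has no flat boundary point;
no hull-subdomain surgery, no restriction passage, no simplicity, no `IsEndpointApprox` transfer), (iii)
the SLE side is a pure, known boundary-exponent statement, and (iv) the existence of a subsequential
limit in the reference square — which is TIGHTNESS, the route's own target T′ — enters BY NAME as the
registered item `SAWRenewalTightness.EventualTight` (stmt-CriticalPhenomena-1372), the Prokhorov step being
PROVED in this file (`subseqLimitsExist_of_eventualTight`, sorry-free).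

  S2 reference square `(D₀; a₀, b₀)`, flat window at `x₀`     T′ ⟹ a subsequential limit `μ₀` in `D₀` along `s∘φ`
  S1 dock along `s∘φ`: ONE `κ > 0` with `μ = SLE_κ(D)` AND `μ₀ = SLE_κ(D₀)`
  S4 lattice area law in `D₀` at `x₀`  ⟹(S5, portmanteau)  `c r² ≤ μ₀(dist ≤ r)`, `μ₀(dist < r) ≤ C r²`
  S6 Alberts–Kozdron / Rohde–Schramm pin in `D₀`: `κ = 8/3`   ⟹  `μ = SLE_{8/3}(D)` = the crux BY NAME.

STUBS (5): S1 `stub_identificationUpToKappa` (DOCK, imported, crux-hard, XXL) · S2 `stub_referenceWindow`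
(M, provable now) · S4 `stub_latticeAreaLaw` (THE LINE'S CONTENT; open, XL; HARDEST line-owned stub) ·
S5 `stub_areaLawOfLimit` (M, provable now) · S6 `stub_kappaPin` (L, known SLE: AK08 two-sided boundary
exponent for κ < 8, upper half PROVED in tree; RS05 space-filling for κ ≥ 8 PROVED in tree). Named input:
`EventualTight` (T′, stmt-CriticalPhenomena-1372). `SubseqIdentification_of` composes S1, S2, the T′-consequence, S4,
S5, S6 (kernel-checked, no `sorry`); `SubseqIdentification_proof (hT : EventualTight)` instantiates it
with the registered stubs; `SubseqIdentification_renewalTightness` transfers it to the identical decl of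
the payload route.

GENERATION-2 CHANGES (vs `sha 268a003d`), each forced by an input:
* S4 WEAKENED to the pointwise-in-`r` eventual form (`∃ C ε₀ ∀ r ∈ (0, ε₀] ∀ᶠ δ`): generation 1 registered
  the fixed-mesh form "∀ᶠ δ, ∀ 2δ ≤ r ≤ r' ≤ ε₀", but its own composition (S5) consumed it only at fixed
  radii; the registered obligation is now exactly what the line uses, it is implied by the LSW conjecture
  (continuity of `r ↦ P^{SLE(8/3)}[dist ≤ r]`, restriction formula), hence consistent with
  `Negative.subseqIdentification_of_sawScalingLimit`, and provers are not forced into lattice-local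
  casework at `r ∼ 2δ`. The fixed-mesh law remains the MECHANISM's natural output and implies the stub
  (`latticeAreaLaw_of_fixedMesh`, sorry-free); the idea's cheapest falsifier (exact enumeration of
  `P_δ(k-block)/[k² p_δ]`, `k = 1,2,3`) still tests the mechanism.
* S3 of generation 1 ("subsequential limits exist", an OPEN stub equal in strength to T′) is REPLACED by
  the registered item `EventualTight` taken BY NAME plus the proved Prokhorov extraction — Disproof cycle 2
  §6 proves `SAWScalingLimit ↔ EventualTight ∧ SubseqIdentification` (tightness is NECESSARY), and §7
  `debt_exists_subseqLimit` is precisely the existential shadow of what the reference square needs; a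
  separate tightness stub would have double-staffed the route's rank-0 target.
* Docstrings cite cycle-2 items 8–12 where they bear (S4: item 11 lattice constants, item 12 wall edges in
  `∂Ω`; S1: item 9, the restriction κ-pin competitor; reversibility debt item 8 is a COROLLARY of the crux
  and constrains no stub).

DISPROOF USED (`Cruxes/SubseqIdentification/Disproof.lean`, cdisprove cycles 1–2, NO KILL; and the LANDED
`Theorems/SubseqIdentification/Negative/{EndpointLoadBearing, Necessity, ProbabilityRedundant}.lean`,
imported above so this file is checked against them):
* `subseqIdentification_false_without_endpointLimits / _fstLimit / _sndLimit` — HONOURED: the dock S1 and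
  the limit stub S5 keep `SAW.IsEndpointApprox` / the convergence hypotheses verbatim (an `IsSLELaw κ D μ`
  conclusion without the endpoint limits is refuted by the Dirac witness
  `Negative.not_isSLELaw_dirac_of_endpoint_ne` for EVERY κ — the stub that uses H = endpoint limits is S1);
  S2/S4 use `IsEndpointApprox D₀ a₀ b₀` of the reference square (Disproof §0b `stdA/stdB` pattern).
* `…_false_without_oneSided / _meshToZero` — HONOURED: every lattice clause is along `𝓝[>] 0`
  (S4 `∀ᶠ δ in 𝓝[>] 0`; S1/S5 `Tendsto s atTop (𝓝[>] 0)`).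
* `subseqIdentification_iff_withoutProb` (§1c) — `IsProbabilityMeasure μ` kept (harmless, derivable); its
  lemma `Negative.eventually_isProbabilityMeasure_law` is USED here (Prokhorov past the junk meshes).
* `Negative.subseqIdentification_of_sawScalingLimit` (necessity, §3/§6) — consistent: S1, S5, S6 and the
  weakened S4 are implied by (or independent of) `SAWScalingLimit`; T′ is implied by it (§6
  `eventualTight_of_sawScalingLimit`). No stub is beyond the conjecture any more.
* §5 reversibility debt (`isSLELaw_swap_of_subseqIdentification`, `debt_sle_eightThirds_reversible`): a
  corollary of the crux, not an input; nothing in this line breaks lattice reversal symmetry (S4's event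
  `{dist(x₀, trace) ≤ r}` is reversal-invariant, `map_sawReverse_law`).
* §8 item 9 (κ-rigidity via exact lattice restriction + LSW03): the COMPETITOR pin inside the same dock —
  recorded in the line card with the exact comparison (it needs the `meshDomain` nesting caveat of item 9,
  continuity of `{γ ∩ A = ∅}` under the identified SLE_κ, the LSW03 converse, and a lattice LOWER bound on
  `P_δ[γ avoids A]` to exclude κ ≥ 8; this line needs S4 instead and handles every κ > 0 in S6).
Negatives index (9 items, 2026-08-16): stmt-0772 (all-δ `Tight`) is avoided — T′ is the repaired (∃ δ₀)
form; stmt-5420 / stmt-8312 / stmt-8261 do not bear (no observable, no fugacity deformation; S4's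
constants are `∃` after `(D, a, b, x₀)` and the window radius is macroscopic).
-/

open MeasureTheory Filter Topology Set
open scoped NNReal ENNReal BoundedContinuousFunction

namespace Summit.CriticalPhenomena.SAWScalingLimit.Cruxes.SubseqIdentification.BoundaryAreaLaw

open Literature.Probability.RandomPlanarGeometry Literature.Probability.LatticeModels
open Summit.CriticalPhenomena.SAWScalingLimit.Theses.SAWParafermion (SubseqIdentification)
open Summit.CriticalPhenomena.SAWScalingLimit.Theses.SAWRenewalTightness (EventualTight)

/-! ## The stubs -/

/-- **S1 — THE DOCK: identification up to `κ` (IMPORTED input of the consuming line; crux-hard, open).**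
For every mesh sequence `s → 0⁺` there is ONE `κ > 0` such that, for every Dobrushin domain `(D; a, b)`,
every endpoint approximation and every probability measure `μ` that is the weak limit along `s` of the
pushed critical SAW laws, `μ` is the chordal SLE_κ law of `(D; a, b)`.
This is the normal form of the output of Schramm's principle (conformal covariance + domain Markov of the
family of subsequential limits ⇒ SLE_κ for one undetermined κ; Schramm2000 §1, LawlerSchrammWerner2004SAW
§4.1) — the penultimate step of every convergence-to-SLE proof, where `κ` is then read off an exponent or
an observable (LERW: a martingale; percolation: Cardy; here: the boundary area law). It is the CONFORMAL
half of the crux and is where the square symmetry of `ℤ²` must be spent (Disproof §4.7,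
`Literature.Barriers.CriticalPhenomena.EmbeddingModulusUniqueness`); this line does not supply it (idea
card `Transfer:`; triage r1-1/r1-3), its suppliers are the cone's CI-first routes (SAWConfRestriction.ConfCovLimit
stmt-CriticalPhenomena-0771, SAWRestrictionRigidity / ZoomRigidity / IsotropicAnchor, with KS describability
`SAWParafermion.KSConditionG2` stmt-CriticalPhenomena-0792 as their first input). It is strictly weaker than the crux
(take κ = 8/3, `identificationUpToKappa_of_crux`), hence true if the LSW conjecture is; it keeps
`IsEndpointApprox` and `𝓝[>] 0` verbatim, honouring
`subseqIdentification_false_without_endpointLimits/_fstLimit/_sndLimit/_oneSided/_meshToZero` (the Dirac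
witness `Negative.not_isSLELaw_dirac_of_endpoint_ne` refutes the endpoint-free version for every κ).
Per-sequence (not per-domain) κ is the weakest form that ties the reference square of S2 to `D`; with a
per-(D, μ) κ the transfer would need germ rigidity / restriction descent. COMPETITOR inside the same dock
(triage r1-1 §D3(b) = Disproof cycle 2 §8 item 9): exact lattice restriction + continuity of `{γ ∩ A = ∅}`
under the identified SLE_κ + the LSW03 converse pin κ = 8/3 among κ < 8 without S4, but need a lattice
lower bound on `P_δ[γ avoids A]` (open, RSW-type) to exclude κ ≥ 8 and the `meshDomain` nesting caveat;
the lead costs the two pins against each other (line card). Size: XXL/open. -/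
theorem stub_identificationUpToKappa :
    ∀ (s : ℕ → ℝ), Tendsto s atTop (𝓝[>] (0 : ℝ)) →
      ∃ κ : ℝ≥0, 0 < κ ∧
        ∀ (D : DobrushinDomain) (a b : ℝ → Site 2), SAW.IsEndpointApprox D a b →
          ∀ (μ : Measure (CurveClass ℂ)), IsProbabilityMeasure μ →
            (∀ f : CurveClass ℂ →ᵇ ℝ,
              Tendsto (fun n => ∫ γ, f γ.curve ∂(SAW.law D.carrier (s n) (a (s n)) (b (s n))))
                atTop (𝓝 (∫ x, f x ∂μ))) →
            IsSLELaw κ D μ := by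
  sorry

/-- **S2 — A REFERENCE DOBRUSHIN DOMAIN WITH A FLAT LATTICE WALL (provable now, M).**
There are a Dobrushin domain `D₀`, an endpoint approximation `(a₀, b₀)` of it (`SAW.IsEndpointApprox`),
a point `x₀` and a radius `ρ₀ > 0` such that `D₀ ∩ B(x₀, ρ₀)` is the open upper half-disc
`{Im z > Im x₀} ∩ B(x₀, ρ₀)` — a straight HORIZONTAL (axis-parallel) wall through `x₀` — and `x₀` is
neither marked point. Intended witness: the open square `(-1,1)²` (tree: `rectDomain 1 1 one_pos one_pos`
of `RectangleConformalMap.lean`, carrier `symRect 1 1`, `frontier_symRect`; marks at the loop parameters of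
`(1,0)` and `(-1,0)`), `a₀ δ = ![⌈δ⁻¹⌉ - 1, 0]`, `b₀ δ = -a₀ δ` (the `stdA/stdB` pattern of
`Negative.CoincidentEndpointLaw`: mesh points `→ ±1`, `dist ≤ δ`, joined along the row `y = 0` inside the
square; the square's mesh-vertex graph is a grid box, hence connected, so `meshDomain = meshVertices`),
`x₀ = -I` (bottom mid-point), `ρ₀ = 1/2`. Any other polygon with an axis-parallel side works. Why a separate
stub: it is the only place where a CONCRETE domain is built, and it fixes the axis-parallel wall the lattice
mechanism of S4 peels along (triage r1-2 sharpen (1)(3): bumps, not bays; constants for a fixed domain). -/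
theorem stub_referenceWindow :
    ∃ (D₀ : DobrushinDomain) (a₀ b₀ : ℝ → Site 2) (x₀ : ℂ) (ρ₀ : ℝ),
      SAW.IsEndpointApprox D₀ a₀ b₀ ∧ 0 < ρ₀ ∧ x₀ ≠ D₀.pt 0 ∧ x₀ ≠ D₀.pt 1 ∧
        D₀.carrier ∩ Metric.ball x₀ ρ₀ = {z : ℂ | x₀.im < z.im} ∩ Metric.ball x₀ ρ₀ := by
  sorry

/-- **S4 — THE LATTICE BOUNDARY AREA LAW (the line's content; OPEN, XL; hardest line-owned stub).**
For a Dobrushin domain `(D; a, b)` with endpoint approximation `(a_δ, b_δ)` and a flat horizontal window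
`D ∩ B(x₀, ρ₀) = {Im z > Im x₀} ∩ B(x₀, ρ₀)` at a wall point `x₀ ∉ {a, b}`, there are `C > 0`, `ε₀ > 0`
such that for EVERY radius `0 < r ≤ ε₀`, for all small meshes `δ` (depending on `r`), the probabilities
`P_δ(r) := P_δ[dist(x₀, trace) ≤ r]` (critical SAW law of `Ω_δ` from `a_δ` to `b_δ`, trace = the polyline
`SAW.DomainSAW.curve`, `CurveClass.range`) satisfy the two-sided AREA LAW against the reference radius `ε₀`:
`C⁻¹ (r/ε₀)² P_δ(ε₀) ≤ P_δ(r) ≤ C (r/ε₀)² P_δ(ε₀)` (written cross-multiplied in `ℝ≥0∞`; equivalent up to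
`C ↦ C²` to the two-radius form `P_δ(r)/P_δ(r') ≍ (r/r')²`; self-normalising: the unknown boundary
one-point function `p_δ(x₀)` cancels — triage r1-1). THIS is the registered obligation: pointwise in `r`,
eventual in `δ`, one pair of constants for all `r` — exactly what S5 consumes; it is implied by the LSW
conjecture (SLE_{8/3} at an analytic boundary point: `P[dist ≤ r] = 1 − (Φ'_r(a)Φ'_r(b))^{5/8} ≍ r²`,
continuous in `r`, so `{dist ≤ r}` is a continuity set). MECHANISM (idea card, sharpened by triage; it
proves MORE, namely the fixed-mesh law `latticeAreaLaw_of_fixedMesh` for all `2δ ≤ r ≤ r' ≤ ε₀`):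
(P1) EXACT PEELING IDENTITY — removing lattice sites from the domain conditions `SAW.law` on avoiding them
(restriction-exactness of the `x_c^{|γ|}` weights; the sub-domain's graph is a subgraph), so
`P_δ[avoid A] = ∏ᵢ (1 - p_{Dᵢ}(ζᵢ))` along any site-by-site peeling and
`|log P_δ[avoid A] + Σ p_{Dᵢ}(ζᵢ)| ≤ Σ pᵢ²/(1 - max pᵢ)`; peel the lattice half-ball of radius `r` at `x₀`
ROW BY ROW, so every intermediate domain is the flat wall with a rectangular BUMP (two reflex corners on
top, two convex wall junctions — r1-2 sharpen (1)); (K1) LAYER-SUMMED BUMP COMPARABILITY — the sum over a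
bump layer of the visit probabilities is within constant factors of (layer length) × (flat-wall visit
probability nearby); only layer sums are used, because sitewise comparability is false at the corners
(reflex corner enhancement `≍ (j/m)^{2/3}`, junction suppression `≍ (m/j)²`, both integrable along the
layer — r1-1 §D3(d), r1-2 (2), r1-3); (K2) BOUNDARY RARITY / translation comparability along the wall —
`P_δ[dist ≤ ε₀] ≤ 1 - c` and `p_δ(x) ≍ p_δ(x')` for wall sites `x, x'` near `x₀` (linearisation input).
Then `P_δ(r) ≍ (r/δ)² p_δ(x₀)`, whence the ratio law. LATTICE GEOMETRY AT THE WALL (checked against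
`DomainDiscretisation.lean` and Disproof cycle 2 §8): mesh vertices lie in the OPEN carrier
(`meshVertices Ω δ = {x | δx ∈ Ω}`), so inside the window `Ω_δ` is the discrete half-plane
`{Im > Im x₀} ∩ δℤ²` with its first row at height `∈ (0, δ]` above the wall (varying with `δ`; absorbed by
the constants, which is one more reason the registered form is eventual in `δ` per radius); item 12
(edges running inside `∂Ω`) cannot occur inside the window, since both endpoints of an edge lie strictly
above the wall; item 11 — Kennedy–Lawler lattice effects (angle-dependent boundary densities) live in the
constants `C`, never in the exponent. Why it might fail: K1/K2 are RSW-type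
up-to-constants estimates for `x_c`-SAW on `ℤ²`, of the class no one can prove yet (no FKG, no
observable; KemppainenSmirnov2017 §4 omits SAW; DuminilCopinHammond2013 is the strongest surgery result) —
the technology that would feed them is this route's own TubeLowerBound (stmt-CriticalPhenomena-4730) / AnnularMassDecay
(stmt-CriticalPhenomena-4729) surgery. Constants depend on `(D, a, b, x₀)` (∃ after ∀ — r1-2 sharpen (3): "uniform in
D" is false, hairline-corridor witness); no non-degeneracy is needed in the ratio form (both sides vanish
together — r1-2 (4)). Affine-invariant (holds verbatim on `diag(1,p)ℤ²`), so it pins nothing without S1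
(declared; `EmbeddingModulusUniqueness` untouched). Cheapest falsifier of the MECHANISM: exact enumeration
in `W×H` boxes (kit j008970 data of the ideator) of `P_δ[SAW hits a k-block of the wall]/[k² p_δ(centre)]`,
`k = 1,2,3`, and of bump-layer visit sums after digging `j ≤ k` rows (must stay within constant factors).
Sources: idea card; FriedrichWerner2003 ("boundary exponent 2"), LawlerSchrammWerner2003Restriction Thm 6.1,
KennedyLawler2013, AlbertsKozdron2007 Thm 1.1. -/
theorem stub_latticeAreaLaw :
    ∀ (D : DobrushinDomain) (a b : ℝ → Site 2), SAW.IsEndpointApprox D a b →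
      ∀ (x₀ : ℂ) (ρ₀ : ℝ), 0 < ρ₀ →
        D.carrier ∩ Metric.ball x₀ ρ₀ = {z : ℂ | x₀.im < z.im} ∩ Metric.ball x₀ ρ₀ →
        x₀ ≠ D.pt 0 → x₀ ≠ D.pt 1 →
        ∃ C ε₀ : ℝ, 0 < C ∧ 0 < ε₀ ∧ ∀ r : ℝ, 0 < r → r ≤ ε₀ →
          ∀ᶠ δ in 𝓝[>] (0 : ℝ),
            SAW.law D.carrier δ (a δ) (b δ) {γ | Metric.infDist x₀ γ.curve.range ≤ r} *
                ENNReal.ofReal (ε₀ ^ 2) ≤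
              ENNReal.ofReal C *
                SAW.law D.carrier δ (a δ) (b δ) {γ | Metric.infDist x₀ γ.curve.range ≤ ε₀} *
                  ENNReal.ofReal (r ^ 2) ∧
            SAW.law D.carrier δ (a δ) (b δ) {γ | Metric.infDist x₀ γ.curve.range ≤ ε₀} *
                ENNReal.ofReal (r ^ 2) ≤
              ENNReal.ofReal C *
                SAW.law D.carrier δ (a δ) (b δ) {γ | Metric.infDist x₀ γ.curve.range ≤ r} *
                  ENNReal.ofReal (ε₀ ^ 2) := by
  sorry

/-- **S5 — AREA LAW OF THE LIMIT (limit passage; provable now, M).**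
If the pushed SAW laws converge weakly to a probability measure `μ` along `s → 0⁺`, the lattice ratio law of
S4 holds along the sequence (cross-multiplied against the reference radius `ε₀`, for every fixed
`0 < r ≤ ε₀` eventually in `n`), and `μ` is non-degenerate at `x₀` (`μ[dist(x₀, trace) < ε] > 0` for every
`ε > 0`), then `μ` satisfies the CONTINUUM two-sided area law `c r² ≤ μ[dist ≤ r]`, `μ[dist < r] ≤ C' r²`
for `0 < r < r₀`. Proof route (portmanteau on the Polish `CurveClass ℂ`; the laws are probability measures
eventually, `Negative.eventually_isProbabilityMeasure_of_tendsto` from the `f ≡ 1` test integral, and have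
mass ≤ 1 always, `Negative.isProbabilityMeasure_law_or_eq_zero`): `c ↦ infDist x₀ c.range` is 1-Lipschitz
on `CurveClass ℂ` (`Curve.infDist_range_le`, pattern of `CurveClass.lipschitzWith_source`), so `{dist ≤ r}` is closed and
`{dist < r}` open, and the convergence hypothesis is weak convergence of the image measures
(`integral_map`, `ProbabilityMeasure.tendsto_iff_forall_integral_tendsto`). Take `r₀ = ε₀`. Upper:
`μ(< r) ≤ liminf P_n(< r) ≤ liminf P_n(≤ r) ≤ C (r/ε₀)² · 1`
(`ProbabilityMeasure.le_liminf_measure_open_of_tendsto`). Lower: `limsup P_n(≤ r) ≤ μ(≤ r)` (closed,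
`ProbabilityMeasure.limsup_measure_closed_le_of_tendsto`) and `P_n(≤ r) ≥ C⁻¹ (r/ε₀)² P_n(≤ ε₀) ≥
C⁻¹ (r/ε₀)² P_n(< ε₀)` with `liminf P_n(< ε₀) ≥ μ(< ε₀) > 0` (open; non-degeneracy), hence
`μ(≤ r) ≥ c r²` with `c = μ(< ε₀)/(C ε₀²)`. Non-degeneracy is an INPUT here (r1-2 sharpen (4)); S6 (i)
supplies it from the dock. -/
theorem stub_areaLawOfLimit :
    ∀ (D : DobrushinDomain) (a b : ℝ → Site 2) (s : ℕ → ℝ) (μ : Measure (CurveClass ℂ)) (x₀ : ℂ),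
      Tendsto s atTop (𝓝[>] (0 : ℝ)) → IsProbabilityMeasure μ →
      (∀ f : CurveClass ℂ →ᵇ ℝ,
        Tendsto (fun n => ∫ γ, f γ.curve ∂(SAW.law D.carrier (s n) (a (s n)) (b (s n))))
          atTop (𝓝 (∫ x, f x ∂μ))) →
      (∃ C ε₀ : ℝ, 0 < C ∧ 0 < ε₀ ∧ ∀ r : ℝ, 0 < r → r ≤ ε₀ → ∀ᶠ n in atTop,
          SAW.law D.carrier (s n) (a (s n)) (b (s n)) {γ | Metric.infDist x₀ γ.curve.range ≤ r} *
                ENNReal.ofReal (ε₀ ^ 2) ≤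
              ENNReal.ofReal C *
                SAW.law D.carrier (s n) (a (s n)) (b (s n))
                    {γ | Metric.infDist x₀ γ.curve.range ≤ ε₀} *
                  ENNReal.ofReal (r ^ 2) ∧
            SAW.law D.carrier (s n) (a (s n)) (b (s n)) {γ | Metric.infDist x₀ γ.curve.range ≤ ε₀} *
                ENNReal.ofReal (r ^ 2) ≤
              ENNReal.ofReal C *
                SAW.law D.carrier (s n) (a (s n)) (b (s n))
                    {γ | Metric.infDist x₀ γ.curve.range ≤ r} *
                  ENNReal.ofReal (ε₀ ^ 2)) →
      (∀ ε : ℝ, 0 < ε → 0 < μ {γ | Metric.infDist x₀ γ.range < ε}) →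
      ∃ c C r₀ : ℝ, 0 < c ∧ 0 < r₀ ∧ ∀ r ∈ Set.Ioo (0 : ℝ) r₀,
        ENNReal.ofReal (c * r ^ 2) ≤ μ {γ | Metric.infDist x₀ γ.range ≤ r} ∧
          μ {γ | Metric.infDist x₀ γ.range < r} ≤ ENNReal.ofReal (C * r ^ 2) := by
  sorry

/-- **S6 — THE κ-PIN: boundary exponent `8/κ − 1 = 2 ⇔ κ = 8/3` (known SLE theory; L).**
Let `μ` be the chordal SLE_κ law (`κ > 0`) of a Dobrushin domain `(D; a, b)` having a flat horizontal window
`D ∩ B(x₀, ρ₀) = {Im z > Im x₀} ∩ B(x₀, ρ₀)` at `x₀ ∉ {a, b}` (so `x₀ ∈ ∂D` lies on a straight boundary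
segment). Then (i) NON-DEGENERACY: `μ[dist(x₀, trace) < ε] > 0` for every `ε > 0`; and (ii) PIN: if `μ`
satisfies a two-sided area law `c r² ≤ μ[dist ≤ r]`, `μ[dist < r] ≤ C r²` for small `r`, then `κ = 8/3`.
Proof route: let `ψ : ℍ → D` be the uniformizer behind `IsSLELaw` (`IsSLECurve`: `μ` = push-forward of the
compactified image of `sleTrace κ` under `ψ.boundaryExtension`; `IsSLELaw.hasSLETrace` gives
`HasSLETrace κ`); `x₀ = ψ(u₀)` with `u₀ ∈ ℝ ∖ {0}` (`x₀ ≠ a, b`; Carathéodory,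
`JordanDomain.exists_hasBoundaryValue`); the flat window makes `ψ` extend ANALYTICALLY across a real interval
around `u₀` with `ψ'(u₀) ≠ 0` (Schwarz reflection — the one place flatness is used on the SLE side), so
`{dist(x₀, ψ∘γ) ≤ r}` is sandwiched between `{dist(u₀, γ) ≤ r/(2|ψ'(u₀)|)}` and `{dist(u₀, γ) ≤ 2r/|ψ'(u₀)|}`
for small `r`. For `0 < κ < 8` the boundary proximity law in `ℍ` is two-sided
`P[dist(u₀, γ) ≤ ρ |u₀|] ≍ ρ^{8/κ−1}` (AlbertsKozdron2007 Thm 1.1; UPPER half PROVED in tree: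
`measure_infDist_ofReal_sleTrace_le` (SLEBoundaryProximity), `measure_infDist_neg_ofReal_sleTrace_le`
(SLEUnifiedHitting) for `u₀ < 0`; lower half to vendor from AK08 §3.2 as a cited fact), so `c r² ≤ C₁ r^{8/κ−1}`
and `c₁ r^{8/κ−1} ≤ C r²` as `r → 0` force `8/κ − 1 = 2`; for `κ ≥ 8` the trace is space-filling (PROVED in
tree: `ae_isSpaceFilling_sleTrace_of_hasSLETrace_apply`, Rohde–Schramm Cor. 7.4 + LSW04 at κ = 8), so
`μ[dist < r] = 1`, contradicting the upper bound — (ii) holds for every `κ > 0`. (i): for κ ≥ 8 by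
space-filling; for κ < 8 from the AK lower bound, or Schramm's left-passage law + scaling (the trace enters
every boundary semi-disc `B(u₀, η) ∩ ℍ` with positive probability) and `ψ(B(u₀, η) ∩ ℍ) ⊆ B(x₀, ε)` for
small `η`. Strict monotonicity of `κ ↦ 8/κ − 1` is what makes the pin sharp (r1-1 §D5, r1-3 check). -/
theorem stub_kappaPin :
    ∀ (κ : ℝ≥0) (D : DobrushinDomain) (μ : Measure (CurveClass ℂ)) (x₀ : ℂ) (ρ₀ : ℝ),
      0 < κ → IsSLELaw κ D μ → 0 < ρ₀ →
      D.carrier ∩ Metric.ball x₀ ρ₀ = {z : ℂ | x₀.im < z.im} ∩ Metric.ball x₀ ρ₀ →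
      x₀ ≠ D.pt 0 → x₀ ≠ D.pt 1 →
      (∀ ε : ℝ, 0 < ε → 0 < μ {γ | Metric.infDist x₀ γ.range < ε}) ∧
        ((∃ c C r₀ : ℝ, 0 < c ∧ 0 < r₀ ∧ ∀ r ∈ Set.Ioo (0 : ℝ) r₀,
            ENNReal.ofReal (c * r ^ 2) ≤ μ {γ | Metric.infDist x₀ γ.range ≤ r} ∧
              μ {γ | Metric.infDist x₀ γ.range < r} ≤ ENNReal.ofReal (C * r ^ 2)) →
          κ = 8 / 3) := by
  sorry

/-! ## The named input T′: tightness gives subsequential limits (Prokhorov along the mesh; sorry-free) -/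

/-- **`EventualTight` ⇒ subsequential limits exist along every mesh sequence** (generation 1's stub S3,
now DERIVED from the route's registered target T′ = stmt-CriticalPhenomena-1372): for every Dobrushin domain, endpoint
approximation and `s → 0⁺` there are a subsequence `s ∘ φ` and a probability measure `μ` on `CurveClass ℂ`
such that the pushed critical SAW laws converge weakly to `μ` along `s ∘ φ`. Re-hosts the disprover's
`exists_subseqConv_of_isTightAlongMesh` / `isTightAlongMesh_of_eventualTight` (Disproof cycle 2 §5.4):
the laws are probability measures past the junk meshes (`Negative.eventually_isProbabilityMeasure_law`),
`EventualTight` gives tightness along the mesh (`isTightAlongMesh_of_isTightMeasureSet_image`), the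
sequence of image laws is a tight set (`isTightMeasureSet_range_of_eventually`), and Prokhorov on the
Polish `CurveClass ℂ` (`isCompact_closure_of_isTightMeasureSet`) extracts the subsequence. [folklore] -/
theorem subseqLimitsExist_of_eventualTight (hT : EventualTight) :
    ∀ (D : DobrushinDomain) (a b : ℝ → Site 2), SAW.IsEndpointApprox D a b →
      ∀ (s : ℕ → ℝ), Tendsto s atTop (𝓝[>] (0 : ℝ)) →
        ∃ φ : ℕ → ℕ, StrictMono φ ∧ ∃ μ : Measure (CurveClass ℂ), IsProbabilityMeasure μ ∧
          ∀ f : CurveClass ℂ →ᵇ ℝ,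
            Tendsto (fun n => ∫ γ, f γ.curve
                ∂(SAW.law D.carrier (s (φ n)) (a (s (φ n))) (b (s (φ n)))))
              atTop (𝓝 (∫ x, f x ∂μ)) := by
  intro D a b hab s hs
  -- tightness along the mesh, from the route's `EventualTight`
  have hT' : IsTightAlongMesh (fun δ (γ : SAW.DomainSAW D.carrier δ (a δ) (b δ)) => γ.curve)
      (fun δ => SAW.law D.carrier δ (a δ) (b δ)) := by
    obtain ⟨δ₀, hδ₀, h⟩ := hT D a b hab
    exact isTightAlongMesh_of_isTightMeasureSet_image
      (Eventually.of_forall fun δ => (SAW.DomainSAW.measurable_of_top _).aemeasurable) hδ₀ h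
  -- past some index the laws are probability measures
  obtain ⟨N, hN⟩ := eventually_atTop.1 (hs.eventually
    (Summit.CriticalPhenomena.SAWScalingLimit.Theorems.SubseqIdentification.Negative.eventually_isProbabilityMeasure_law
      hab))
  have hN' : ∀ n, IsProbabilityMeasure (SAW.law D.carrier (s (n + N)) (a (s (n + N))) (b (s (n + N)))) :=
    fun n => hN _ (N.le_add_left n)
  let ν : ℕ → ProbabilityMeasure (CurveClass ℂ) := fun n =>
    ⟨(SAW.law D.carrier (s (n + N)) (a (s (n + N))) (b (s (n + N)))).map (fun γ => γ.curve),
      Measure.isProbabilityMeasure_map (SAW.DomainSAW.measurable_of_top _).aemeasurable⟩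
  have hνapply : ∀ n (K : Set (CurveClass ℂ)), IsClosed K → (ν n : Measure (CurveClass ℂ)) Kᶜ =
      SAW.law D.carrier (s (n + N)) (a (s (n + N))) (b (s (n + N))) ((fun γ => γ.curve) ⁻¹' Kᶜ) :=
    fun n K hK => Measure.map_apply (SAW.DomainSAW.measurable_of_top _) hK.isOpen_compl.measurableSet
  have htight : IsTightMeasureSet
      {((μ : ProbabilityMeasure (CurveClass ℂ)) : Measure (CurveClass ℂ)) | μ ∈ Set.range ν} := by
    have hrange : {((μ : ProbabilityMeasure (CurveClass ℂ)) : Measure (CurveClass ℂ)) | μ ∈ Set.range ν}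
        = Set.range (fun n => (ν n : Measure (CurveClass ℂ))) := by
      ext x
      simp only [Set.mem_range, Set.mem_setOf_eq]
      constructor
      · rintro ⟨μ, ⟨n, rfl⟩, rfl⟩
        exact ⟨n, rfl⟩
      · rintro ⟨n, rfl⟩
        exact ⟨ν n, ⟨n, rfl⟩, rfl⟩
    rw [hrange]
    haveI : ∀ n, IsFiniteMeasure ((fun n => (ν n : Measure (CurveClass ℂ))) n) := fun n => by
      change IsFiniteMeasure (ν n : Measure (CurveClass ℂ))
      infer_instance
    refine isTightMeasureSet_range_of_eventually fun ε hε => ?_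
    obtain ⟨K, hK, hev⟩ := hT' ε hε
    refine ⟨K, hK, ?_⟩
    have hs' : Tendsto (fun n => s (n + N)) atTop (𝓝[>] (0 : ℝ)) := hs.comp (tendsto_add_atTop_nat N)
    filter_upwards [hs'.eventually hev] with n hn
    rwa [hνapply n K hK.isClosed]
  have hcomp := isCompact_closure_of_isTightMeasureSet htight
  obtain ⟨μ, -, φ, hφ, hlim⟩ := hcomp.isSeqCompact fun n => subset_closure (Set.mem_range_self n)
  refine ⟨fun n => φ n + N, fun m n hmn => Nat.add_lt_add_right (hφ hmn) N, μ, inferInstance,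
    fun f => ?_⟩
  have := (ProbabilityMeasure.tendsto_iff_forall_integral_tendsto.1 hlim) f
  refine this.congr fun n => ?_
  change ∫ x, f x ∂((SAW.law D.carrier (s (φ n + N)) (a (s (φ n + N))) (b (s (φ n + N)))).map
    (fun γ => γ.curve)) = _
  exact integral_map (SAW.DomainSAW.measurable_of_top _).aemeasurable f.continuous.aestronglyMeasurable

/-! ## The composition -/

/-- **Composition `S1 → S2 → (T′-consequence) → S4 → S5 → S6 → SubseqIdentification` (kernel-checked, no
`sorry`).** Given the crux hypotheses for `(D; a, b)`, `s`, `μ`: take the reference square `(D₀; a₀, b₀)`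
with its flat window at `x₀` (S2) and a subsequential limit `μ₀` of its SAW laws along `s ∘ φ` (h₃, the
consequence of T′); the dock (S1) applied to the sequence `s ∘ φ` gives ONE `κ > 0` with `μ = SLE_κ(D)`
(the laws in `D` still converge to `μ` along the subsequence) and `μ₀ = SLE_κ(D₀)`; the lattice area law in
`D₀` at `x₀` (S4), transported along `s ∘ φ` (`Tendsto.eventually`, radius by radius) and passed to the
limit (S5, with non-degeneracy from S6 (i)), gives the two-sided `r²` law for `μ₀`, and the pin (S6 (ii))
gives `κ = 8/3`; hence `IsSLELaw (8/3) D μ`, which is `SAWParafermion.SubseqIdentification` BY NAME (the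
ledger's primary decl of stmt-CriticalPhenomena-0783; the identical shared decl `SAWRenewalTightness.SubseqIdentification`
follows definitionally, `SubseqIdentification_renewalTightness`). -/
theorem SubseqIdentification_of
    (h₁ : ∀ (s : ℕ → ℝ), Tendsto s atTop (𝓝[>] (0 : ℝ)) →
      ∃ κ : ℝ≥0, 0 < κ ∧
        ∀ (D : DobrushinDomain) (a b : ℝ → Site 2), SAW.IsEndpointApprox D a b →
          ∀ (μ : Measure (CurveClass ℂ)), IsProbabilityMeasure μ →
            (∀ f : CurveClass ℂ →ᵇ ℝ,
              Tendsto (fun n => ∫ γ, f γ.curve ∂(SAW.law D.carrier (s n) (a (s n)) (b (s n))))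
                atTop (𝓝 (∫ x, f x ∂μ))) →
            IsSLELaw κ D μ)
    (h₂ : ∃ (D₀ : DobrushinDomain) (a₀ b₀ : ℝ → Site 2) (x₀ : ℂ) (ρ₀ : ℝ),
      SAW.IsEndpointApprox D₀ a₀ b₀ ∧ 0 < ρ₀ ∧ x₀ ≠ D₀.pt 0 ∧ x₀ ≠ D₀.pt 1 ∧
        D₀.carrier ∩ Metric.ball x₀ ρ₀ = {z : ℂ | x₀.im < z.im} ∩ Metric.ball x₀ ρ₀)
    (h₃ : ∀ (D : DobrushinDomain) (a b : ℝ → Site 2), SAW.IsEndpointApprox D a b →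
      ∀ (s : ℕ → ℝ), Tendsto s atTop (𝓝[>] (0 : ℝ)) →
        ∃ φ : ℕ → ℕ, StrictMono φ ∧ ∃ μ : Measure (CurveClass ℂ), IsProbabilityMeasure μ ∧
          ∀ f : CurveClass ℂ →ᵇ ℝ,
            Tendsto (fun n => ∫ γ, f γ.curve
                ∂(SAW.law D.carrier (s (φ n)) (a (s (φ n))) (b (s (φ n)))))
              atTop (𝓝 (∫ x, f x ∂μ)))
    (h₄ : ∀ (D : DobrushinDomain) (a b : ℝ → Site 2), SAW.IsEndpointApprox D a b →
      ∀ (x₀ : ℂ) (ρ₀ : ℝ), 0 < ρ₀ →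
        D.carrier ∩ Metric.ball x₀ ρ₀ = {z : ℂ | x₀.im < z.im} ∩ Metric.ball x₀ ρ₀ →
        x₀ ≠ D.pt 0 → x₀ ≠ D.pt 1 →
        ∃ C ε₀ : ℝ, 0 < C ∧ 0 < ε₀ ∧ ∀ r : ℝ, 0 < r → r ≤ ε₀ →
          ∀ᶠ δ in 𝓝[>] (0 : ℝ),
            SAW.law D.carrier δ (a δ) (b δ) {γ | Metric.infDist x₀ γ.curve.range ≤ r} *
                ENNReal.ofReal (ε₀ ^ 2) ≤
              ENNReal.ofReal C *
                SAW.law D.carrier δ (a δ) (b δ) {γ | Metric.infDist x₀ γ.curve.range ≤ ε₀} *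
                  ENNReal.ofReal (r ^ 2) ∧
            SAW.law D.carrier δ (a δ) (b δ) {γ | Metric.infDist x₀ γ.curve.range ≤ ε₀} *
                ENNReal.ofReal (r ^ 2) ≤
              ENNReal.ofReal C *
                SAW.law D.carrier δ (a δ) (b δ) {γ | Metric.infDist x₀ γ.curve.range ≤ r} *
                  ENNReal.ofReal (ε₀ ^ 2))
    (h₅ : ∀ (D : DobrushinDomain) (a b : ℝ → Site 2) (s : ℕ → ℝ) (μ : Measure (CurveClass ℂ))
        (x₀ : ℂ),
      Tendsto s atTop (𝓝[>] (0 : ℝ)) → IsProbabilityMeasure μ →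
      (∀ f : CurveClass ℂ →ᵇ ℝ,
        Tendsto (fun n => ∫ γ, f γ.curve ∂(SAW.law D.carrier (s n) (a (s n)) (b (s n))))
          atTop (𝓝 (∫ x, f x ∂μ))) →
      (∃ C ε₀ : ℝ, 0 < C ∧ 0 < ε₀ ∧ ∀ r : ℝ, 0 < r → r ≤ ε₀ → ∀ᶠ n in atTop,
          SAW.law D.carrier (s n) (a (s n)) (b (s n)) {γ | Metric.infDist x₀ γ.curve.range ≤ r} *
                ENNReal.ofReal (ε₀ ^ 2) ≤
              ENNReal.ofReal C *
                SAW.law D.carrier (s n) (a (s n)) (b (s n))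
                    {γ | Metric.infDist x₀ γ.curve.range ≤ ε₀} *
                  ENNReal.ofReal (r ^ 2) ∧
            SAW.law D.carrier (s n) (a (s n)) (b (s n)) {γ | Metric.infDist x₀ γ.curve.range ≤ ε₀} *
                ENNReal.ofReal (r ^ 2) ≤
              ENNReal.ofReal C *
                SAW.law D.carrier (s n) (a (s n)) (b (s n))
                    {γ | Metric.infDist x₀ γ.curve.range ≤ r} *
                  ENNReal.ofReal (ε₀ ^ 2)) →
      (∀ ε : ℝ, 0 < ε → 0 < μ {γ | Metric.infDist x₀ γ.range < ε}) →
      ∃ c C r₀ : ℝ, 0 < c ∧ 0 < r₀ ∧ ∀ r ∈ Set.Ioo (0 : ℝ) r₀,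
        ENNReal.ofReal (c * r ^ 2) ≤ μ {γ | Metric.infDist x₀ γ.range ≤ r} ∧
          μ {γ | Metric.infDist x₀ γ.range < r} ≤ ENNReal.ofReal (C * r ^ 2))
    (h₆ : ∀ (κ : ℝ≥0) (D : DobrushinDomain) (μ : Measure (CurveClass ℂ)) (x₀ : ℂ) (ρ₀ : ℝ),
      0 < κ → IsSLELaw κ D μ → 0 < ρ₀ →
      D.carrier ∩ Metric.ball x₀ ρ₀ = {z : ℂ | x₀.im < z.im} ∩ Metric.ball x₀ ρ₀ →
      x₀ ≠ D.pt 0 → x₀ ≠ D.pt 1 →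
      (∀ ε : ℝ, 0 < ε → 0 < μ {γ | Metric.infDist x₀ γ.range < ε}) ∧
        ((∃ c C r₀ : ℝ, 0 < c ∧ 0 < r₀ ∧ ∀ r ∈ Set.Ioo (0 : ℝ) r₀,
            ENNReal.ofReal (c * r ^ 2) ≤ μ {γ | Metric.infDist x₀ γ.range ≤ r} ∧
              μ {γ | Metric.infDist x₀ γ.range < r} ≤ ENNReal.ofReal (C * r ^ 2)) →
          κ = 8 / 3)) :
    SubseqIdentification := by
  intro D a b hab s μ hs hμ hlim
  -- S2: the reference square with its flat window
  obtain ⟨D₀, a₀, b₀, x₀, ρ₀, hab₀, hρ₀, hx0, hx1, hwin⟩ := h₂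
  -- T′-consequence: a subsequential limit in the reference domain along `s ∘ φ`
  obtain ⟨φ, hφ, μ₀, hμ₀, hlim₀⟩ := h₃ D₀ a₀ b₀ hab₀ s hs
  have hs' : Tendsto (s ∘ φ) atTop (𝓝[>] (0 : ℝ)) := hs.comp hφ.tendsto_atTop
  -- S1: one `κ` along `s ∘ φ` for both `D` and `D₀`
  obtain ⟨κ, hκ, hdock⟩ := h₁ (s ∘ φ) hs'
  have hD : IsSLELaw κ D μ :=
    hdock D a b hab μ hμ fun f => (hlim f).comp hφ.tendsto_atTop
  have hD₀ : IsSLELaw κ D₀ μ₀ := hdock D₀ a₀ b₀ hab₀ μ₀ hμ₀ hlim₀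
  -- S4: the lattice area law in the reference domain, transported radius by radius along the subsequence
  obtain ⟨C, ε₀, hC, hε₀, hlaw⟩ := h₄ D₀ a₀ b₀ hab₀ x₀ ρ₀ hρ₀ hwin hx0 hx1
  -- S6: non-degeneracy and the pin for `μ₀ = SLE_κ(D₀)`
  obtain ⟨hnd, hpin⟩ := h₆ κ D₀ μ₀ x₀ ρ₀ hκ hD₀ hρ₀ hwin hx0 hx1
  -- S5: the continuum two-sided `r²` law for `μ₀`
  have htwo := h₅ D₀ a₀ b₀ (s ∘ φ) μ₀ x₀ hs' hμ₀ hlim₀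
    ⟨C, ε₀, hC, hε₀, fun r hr hrε => hs'.eventually (hlaw r hr hrε)⟩ hnd
  have hk : κ = 8 / 3 := hpin htwo
  rw [hk] at hD
  exact hD

/-- **`<Crux>_proof`**: the composition instantiated with the registered stubs of this file and the route's
registered target T′ (`SAWRenewalTightness.EventualTight`, stmt-CriticalPhenomena-1372, taken BY NAME) — the line closes the
crux BY NAME (`SAWParafermion.SubseqIdentification`, primary decl of stmt-CriticalPhenomena-0783) as soon as every `stub_*`
is proved and T′ has landed. -/
theorem SubseqIdentification_proof (hT : EventualTight) : SubseqIdentification :=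
  SubseqIdentification_of stub_identificationUpToKappa stub_referenceWindow
    (subseqLimitsExist_of_eventualTight hT) stub_latticeAreaLaw stub_areaLawOfLimit stub_kappaPin

/-- The shared decl of route `SAWRenewalTightness` (payload route; identical body, deduplicated by the ledger)
is closed by the same term, definitionally — and there T′ is the route's own rank-0 target, the other
hypothesis of its deciding theorem `closes (hT : EventualTight) (hI : SubseqIdentification)`. -/
theorem SubseqIdentification_renewalTightness (hT : EventualTight) :
    Summit.CriticalPhenomena.SAWScalingLimit.Theses.SAWRenewalTightness.SubseqIdentification :=
  SubseqIdentification_proof hT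

/-! ## Sanity anchors (sorry-free) -/

/-- The dock S1 with `κ := 8/3` IS implied by the crux (so S1 is weaker than, not a restatement of, the
crux; and it is true if the LSW conjecture is). [folklore] -/
theorem identificationUpToKappa_of_crux (h : SubseqIdentification) :
    ∀ (s : ℕ → ℝ), Tendsto s atTop (𝓝[>] (0 : ℝ)) →
      ∃ κ : ℝ≥0, 0 < κ ∧
        ∀ (D : DobrushinDomain) (a b : ℝ → Site 2), SAW.IsEndpointApprox D a b →
          ∀ (μ : Measure (CurveClass ℂ)), IsProbabilityMeasure μ →
            (∀ f : CurveClass ℂ →ᵇ ℝ,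
              Tendsto (fun n => ∫ γ, f γ.curve ∂(SAW.law D.carrier (s n) (a (s n)) (b (s n))))
                atTop (𝓝 (∫ x, f x ∂μ))) →
            IsSLELaw κ D μ :=
  fun s hs => ⟨8 / 3, by positivity, fun D a b hab μ hμ hlim => h D a b hab s μ hs hμ hlim⟩

/-- **The fixed-mesh area law implies the registered stub S4.** The idea card's / generation 1's form of the
area law — ONE pair of constants for all small meshes `δ` and ALL mesoscopic radii `2δ ≤ r ≤ r' ≤ ε₀` at
once (what the peeling mechanism actually delivers) — implies the pointwise-in-`r` form registered as
`stub_latticeAreaLaw` (take `r' = ε₀`; for fixed `r > 0`, eventually `2δ ≤ r`). A prover who proves the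
fixed-mesh law closes S4 through this lemma. [folklore] -/
theorem latticeAreaLaw_of_fixedMesh {D : DobrushinDomain} {a b : ℝ → Site 2} {x₀ : ℂ}
    (h : ∃ C ε₀ : ℝ, 0 < C ∧ 0 < ε₀ ∧ ∀ᶠ δ in 𝓝[>] (0 : ℝ), ∀ r r' : ℝ,
          2 * δ ≤ r → r ≤ r' → r' ≤ ε₀ →
          SAW.law D.carrier δ (a δ) (b δ) {γ | Metric.infDist x₀ γ.curve.range ≤ r} *
                ENNReal.ofReal (r' ^ 2) ≤
              ENNReal.ofReal C *
                SAW.law D.carrier δ (a δ) (b δ) {γ | Metric.infDist x₀ γ.curve.range ≤ r'} *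
                  ENNReal.ofReal (r ^ 2) ∧
            SAW.law D.carrier δ (a δ) (b δ) {γ | Metric.infDist x₀ γ.curve.range ≤ r'} *
                ENNReal.ofReal (r ^ 2) ≤
              ENNReal.ofReal C *
                SAW.law D.carrier δ (a δ) (b δ) {γ | Metric.infDist x₀ γ.curve.range ≤ r} *
                  ENNReal.ofReal (r' ^ 2)) :
    ∃ C ε₀ : ℝ, 0 < C ∧ 0 < ε₀ ∧ ∀ r : ℝ, 0 < r → r ≤ ε₀ →
      ∀ᶠ δ in 𝓝[>] (0 : ℝ),
        SAW.law D.carrier δ (a δ) (b δ) {γ | Metric.infDist x₀ γ.curve.range ≤ r} *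
            ENNReal.ofReal (ε₀ ^ 2) ≤
          ENNReal.ofReal C *
            SAW.law D.carrier δ (a δ) (b δ) {γ | Metric.infDist x₀ γ.curve.range ≤ ε₀} *
              ENNReal.ofReal (r ^ 2) ∧
        SAW.law D.carrier δ (a δ) (b δ) {γ | Metric.infDist x₀ γ.curve.range ≤ ε₀} *
            ENNReal.ofReal (r ^ 2) ≤
          ENNReal.ofReal C *
            SAW.law D.carrier δ (a δ) (b δ) {γ | Metric.infDist x₀ γ.curve.range ≤ r} *
              ENNReal.ofReal (ε₀ ^ 2) := by
  obtain ⟨C, ε₀, hC, hε₀, hlaw⟩ := h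
  refine ⟨C, ε₀, hC, hε₀, fun r hr hrε => ?_⟩
  have hsmall : ∀ᶠ δ in 𝓝[>] (0 : ℝ), 2 * δ ≤ r := by
    have h2 : ∀ᶠ δ in 𝓝 (0 : ℝ), δ < r / 2 := eventually_lt_nhds (by linarith)
    exact (h2.filter_mono nhdsWithin_le_nhds).mono fun δ hδ => by linarith
  filter_upwards [hlaw, hsmall] with δ hδ h2δ
  exact hδ r ε₀ h2δ hrε le_rfl

end Summit.CriticalPhenomena.SAWScalingLimit.Cruxes.SubseqIdentification.BoundaryAreaLaw
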